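import Literature.AlgebraicGeometry.Frobenioids.BiratPreservesUnits
import HarnessLib

/-!
# Frobenioids I, Theorem 3.4 (v), a first step: over a SLIM base an equivalence preserves `O^×(−)`

Mochizuki, *The geometry of Frobenioids I: the general theory*, Kyushu J. Math. **62** (2008)
293–400, Thm. 3.4 (v) p. 63 ("Suppose … (c) `D_1`, `D_2` are slim. Then `Ψ` preserves the base-identity
endomorphisms …") and its proof pp. 67–69 (the categories `P_i = C_i^{pl-bk}`, `(P_i)_A ⥲ (D_i)_{A_D}`
by Def. 1.3 (i)(c), slimness of `D_i`) [cite: MochizukiFrdI2008, Thm. 3.4 (v) p.63].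

PROOF-ONLY file (seat abc-iut-L1-d4 gen 2; S1 piece toward Thm. 3.4 (v), L1-lead R59 (3)/R64 (3)): the
AUTOMORPHISM case of the first sentence of (v) — `Ψ` carries `O^×(A)` (base-identity automorphisms) into
`O^×(Ψ A)` — is the relative transport theorem `mapIso_mem_unitsSubgroup_of_pull_eq`
(`BiratPreservesUnits.lean`) at the ZERO test monoids: the "projects to a `0`-identity" condition is
vacuous and Div-slimness for `0_D` is slimness of `D` (Def. 4.5 (iv): "if `D` is slim, then it is
Div-slim"). Inputs, by name: `Ψ⁻¹` preserves pull-back morphisms (Thm. 3.4 (iii)), Def. 1.3 (i)(c) for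
`C₂` (a Frobenioid), `D₂` slim. No Theorem 4.2 input is needed in this case. Nothing of [FrdI] is restated.
-/

namespace Literature.AlgebraicGeometry.Frobenioids

open CategoryTheory Opposite

universe w v v' u u'

namespace PreFrobenioid

variable {D₁ : Type u} [Category.{v} D₁] {Φ₁ : D₁ᵒᵖ ⥤ CommMonCat.{w}} {C₁ : Type u'} [Category.{v'} C₁]
  {D₂ : Type u} [Category.{v} D₂] {Φ₂ : D₂ᵒᵖ ⥤ CommMonCat.{w}} {C₂ : Type u'} [Category.{v'} C₂]

/-- **[FrdI] Thm. 3.4 (v), first sentence, automorphism case over SLIM bases**: an equivalence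
`Ψ : C₁ ⥲ C₂` of pre-Frobenioids whose quasi-inverse preserves pull-back morphisms (Thm. 3.4 (iii)),
with `C₂` satisfying Def. 1.3 (i)(c) and `D₂` slim, carries `O^×(A)` into `O^×(Ψ A)` — i.e. `Ψ`
preserves base-identity (linear) automorphisms. [cite: MochizukiFrdI2008, Thm. 3.4 (v) p.63] -/
theorem mapIso_mem_unitsSubgroup_of_isSlim (F₁ : C₁ ⥤ ElemFrobenioid Φ₁) (F₂ : C₂ ⥤ ElemFrobenioid Φ₂)
    (Ψ : C₁ ≌ C₂) (hic₂ : ∀ B : C₂, (pullbackSliceToBase F₂ B).IsEquivalence) (hslim : IsSlim D₂)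
    (hpb' : ∀ {Y Z : C₂} (δ : Y ⟶ Z), IsPullbackMorphism F₂ δ → IsPullbackMorphism F₁ (Ψ.inverse.map δ))
    {A : C₁} (f : Aut A) (hf : f ∈ unitsSubgroup F₁ A) :
    Ψ.functor.mapIso f ∈ unitsSubgroup F₂ (Ψ.functor.obj A) := by
  refine mapIso_mem_unitsSubgroup_of_pull_eq (Φ₁ := zeroMonoid.{w} D₁) (Φ₂ := zeroMonoid.{w} D₂) F₁ F₂ Ψ
    hic₂ (fun X α _ => ?_) (fun δ hδ => hpb' δ hδ) (fun X φ _ => MonoidHom.ext fun x => rfl)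
    f hf
  have := hslim.isRigid_forget X α
  rw [this]
  rfl

/-- The same for a Frobenioid `C₂` (Def. 1.3 (i)(c) from `IsFrobenioid`). [cite: MochizukiFrdI2008, Thm. 3.4 (v) p.63] -/
theorem mapIso_mem_unitsSubgroup_of_isSlim' (F₁ : C₁ ⥤ ElemFrobenioid Φ₁) (F₂ : C₂ ⥤ ElemFrobenioid Φ₂)
    (Ψ : C₁ ≌ C₂) (hF₂ : IsFrobenioid F₂) (hslim : IsSlim D₂)
    (hpb' : ∀ {Y Z : C₂} (δ : Y ⟶ Z), IsPullbackMorphism F₂ δ → IsPullbackMorphism F₁ (Ψ.inverse.map δ))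
    {A : C₁} (f : Aut A) (hf : f ∈ unitsSubgroup F₁ A) :
    Ψ.functor.mapIso f ∈ unitsSubgroup F₂ (Ψ.functor.obj A) :=
  mapIso_mem_unitsSubgroup_of_isSlim F₁ F₂ Ψ (fun B => hF₂.i_c B) hslim hpb' f hf

end PreFrobenioid

end Literature.AlgebraicGeometry.Frobenioids
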